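import Summits.Schanuel.Schanuel.Theorems.RootDecomp1KHyperellipticSiegel05

/-!
# RootDecomp1KSuperellipticSiegel — lens 1, generation 63, NODE 24 «SUPERELLIPTIC SIEGEL ON THE K-LINE — the lacunary dominant-far sector» (the superelliptic Siegel–LeVeque theorem y^m = f(x), m ≥ 3, f with two simple roots, over any number field — PROVED from the tree's unit equation via the cyclotomic–Kummer tower and Siegel's identity; the engine on DOMINANT LACUNARY pairs c_k(Y)·x^k + c₀(Y), k ≥ 3 ⇒ SiegelClause / LevelFinite / ThinFibreAt ∀ m₀ / BddLevelEmpty, intrinsically the class DomSuper P; the genus-six family T j := x³ − (Y⁷ + (4j+2)Y − (4j+2)) decided hypothesis-free ∀ j ∈ ℤ; the territory T_territory incl. 2-adic liveness by size at m₀ = 2; CLAIM L2927, PRICE L2930, K-R55) — part 1 (RootDecomp1KSuperellipticSiegel01): §L floors: the local m-divisibility lemma, Siegel's factors / identity / ratio (section Local), the cyclotomic–Kummer tower, the bad places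

(lens-1 g63 NODE 24 «SUPERELLIPTIC SIEGEL ON THE K-LINE — the LACUNARY DOMINANT-FAR SECTOR» L2940/L2941: HOME kernel K = HOME/decomp-schanuel-lens-1/g63/lean/SuperellipticSiegel.lean sha256 f78e5b9a…, 1410 l, ONE namespace `Summit.Schanuel.Schanuel.Theorems.RootDecomp1KSuperellipticSiegel`, imports the tree port …RootDecomp1KHyperellipticSiegel05 ONLY (node 23's part 01 carries the PROVED Literature modules SiegelCubicReduction / UnitEquationFinite / SIntegersFiniteExtension; no …Proofs umbrella, no fact file); no private, no instance, no set_option, no notation, no sorry, no decide; CLAIM L2927, census LIVENESS-v29 (rows T 0 / T 17 tabled on request, OF RECORD L2931 with the critic's territory certificate; keys domSuper / ladder / superell / galtop), crit g12 PRICE L2930 (PAYABLE THEOREM ×1 EX ANTE for (L)+(E)+(F)+(T) jointly under RULE K-R54 (iii) — the superelliptic grade, the LAST credit on the integral-points lane; CHECKLIST K-g63 (1)–(11); RULE K-R55 PRE-ANNOUNCED), writer g33 NOTE 8 L2928 (pre-check 16/16), critic VERDICT: CLEARED — THEOREM ×1 for (L)+(E)+(F)+(T) JOINTLY, ONE credit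 (RULE K-R54 (iii), the superelliptic grade — the LAST credit on the integral-points lane), VERDICT L2943 (crit-1 g12, 2026-09-01T23:12Z): CHECKLIST K-g63 (1)–(11) met item by item on the critic's own farm runs (K rc 0 · 0 errors · 0 sorries; Probe rc 0 with 253 `#print axioms` guards ⊆ the standard triple; Ctrl0 rc 0; Ctrl rc 1 = exactly the 53 planted errors; L_standalone rc 0 ⇒ §L is K-line-independent modulo node 23's Literature-only part 01); TALLY lens-1 ×21 + THEOREM ×23; RULE K-R55 FIXED ((i) toolkit ∪= superelliptic integral-point Siegel — THE INTEGRAL-POINTS LANE IS CLOSED; (ii) open territory at m₀ = 2 := K-R54 (ii) territory not reached by (i): NON-DOMINANT (standing witness W4) and DOMINANT-FAR NON-LACUNARY (standing witness X3); (iii) payable clause; (iv) unconditional part ∪= the node-24 tree names after the port); PORT GO L2944 exactly as census STAGING NOTE 15 L2942 (six parts; the two docstring-preserving boundary moves approved; no privatisation). Port by census-1 gen 24 per NODE-g63.md §(11) as `RootDecomp1KSuperellipticSiegel01–06` (`--supports stmt-Schanuel-33364`; the item stays OPEN; no census credit): 01 = §L floors (section Local: the m-divisibility lemma `natCast_dvd_log_map_sub_of_pow_eq_mul_prod`,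 Siegel's factors / identity / ratio `geomSum_mul_sub_eq` / `map_sub_mul_eq_one` / `siegel_identity_pow` / `eq_of_ratio`; the cyclotomic + Kummer tower `exists_numberField_forall_mem_selmerGroup_isPow` / `exists_numberField_forall_isPow_of_dvd`; bad places `exists_finite_places`); 02 = §L main theorem `finite_integer_pow_eq_of_unitEquation` (U-binder verbatim as the tree's cubic case) + `finite_integer_pow_eq` (unconditional by `finite_unitEquation`) + `finite_integer_pow_eq_of_separable`; 03 = §E the engine on dominant LACUNARY pairs of x-degree k ≥ 3 (the `_lac` chain over node 23's `den_dvd_of_dyadic`, `def DomSuper`, `domSuper_xPolyP_iff` / `domSuper_twoTermP_iff`, the doors `siegelClause_of_domSuper` / `levelFinite_of_domSuper` / `thinFibreAt_of_domSuper` / `bddLevelEmpty_of_domSuper`, disjointness `not_domHyper_of_domSuper` / `not_domSuper_*`) (section Engine); 04 = §F the family `A j`, `tC`, `T j` (`T_eq_twoTermP`), `isEisensteinAt_A` ⇒ `domSuper_T` ⇒ `levelFinite_T` / `thinFibreAt_T` / `siegelClause_T` / … (section Family); 05 = §T part 1 (coefficient read-backs, shape refusals, the deciders' negations, GaussAt 3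 and the ladder at 3, the anchor (1, 1), the odd-prime sieves refused, real liveness) (section Territory, to be continued); 06 = §T part 2 ((T-2) `den_pow_seven_le_T` / `den_pow_lt_T` / `not_thin_ineq_two_T`, `thinFibreAt_two_iff_levelFinite_T`, `T_territory`, `T'` with `T'_zero` / `T'_one` / `T'_territory`) (section Territory re-opened with K's own open-lines). Literature / node-23 twins are CITED by name, never restated. Text = K VERBATIM (every declaration documented by the lens; statements and proofs unchanged; K's module docstring kept in part 01 below this provenance block).)
-/

/-!
# RootDecomp1KSuperellipticSiegel — lens 1, generation 63, NODE 24 «SUPERELLIPTIC SIEGEL ON THE K-LINE — the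
# lacunary dominant-far sector» (CLAIM L2927)

§L  THE SUPERELLIPTIC SIEGEL–LEVEQUE THEOREM, PROVED FROM THE UNIT EQUATION (Shorey–Tijdeman Ch. 6 Thm 6.1 / Ch. 8
    Thm 8.1 shape; Bombieri–Gubler Remark 5.3.8 «details left to the reader»): for a number field `L`, a finite set `T`
    of finite places, `m ≥ 3`, and `f = g·h ∈ L[X]` with `g` SEPARABLE of degree `≥ 2` and COPRIME to `h` (so `f` has
    two simple roots), the set `{x ∈ R_T | ∃ y ∈ L, y ^ m = f(x)}` is FINITE — `finite_integer_pow_eq_of_unitEquation`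
    (U-binder verbatim as in the tree's `finite_integer_sq_eq_of_unitEquation`) and the UNCONDITIONAL
    `finite_integer_pow_eq` by `Literature…UnitEquationFinite.finite_unitEquation` (PROVED, B–G 5.2.1).  Proof
    (Siegel 1926 / Kummer): over `F₁ = SplittingField (f · Φ_m)` (all roots of `f`, a primitive `m`-th root `ζ`) and
    the KUMMER FIELD `F₂ ⊇ F₁` in which every class of `F₁(T₁, m)` is an `m`-th power
    (`exists_numberField_forall_mem_selmerGroup_isPow`, the tree's square-case GENERALISED), the LOCAL LEMMA
    `natCast_dvd_log_map_sub_of_pow_eq_mul_prod` (`m ∣ ord_v(x − e)` at a simple root `e`) makes `x − e₁ = w₁^m`,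
    `x − e₂ = w₂^m`; the three numbers `uᵢ = w₁ − ζ^i w₂` (`i = 0, 1, 2`; here `m ≥ 3` is used) divide the unit
    `e₂ − e₁` with integral cofactors (`geom_sum₂_mul`), so they are units, and SIEGEL'S IDENTITY
    `(1 + ζ)u₁ = ζu₀ + u₂` is a unit equation `U + V = 1`; `x` is an explicit function `Ψ(U)` of `U`.
§E  THE ENGINE on the K-line: the DOMINANT LACUNARY class of `x`-degree `k ≥ 3` — `P = c_k(Y)·x^k + c₀(Y)`,
    `deg c_k < deg c₀`, `c₀` separable over ℚ of degree `≥ 2` and coprime to `c_k` — satisfies `SiegelClause`,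
    `LevelFinite`, `ThinFibreAt m₀` for EVERY `m₀`, `BddLevelEmpty`; intrinsically the class `DomSuper P`.
§F  THE FAMILY `T j := x³ − (Y⁷ + (4j+2)(Y − 1))`, `j ∈ ℤ` (2-Eisenstein, genus 6), decided hypothesis-free.
§T  THE TERRITORY CERTIFICATE `T_territory` (undecided of record at `m₀ = 2` by every tree name; the smooth level-1
    point `(1, 1)`; real-live; 2-adically live by size: `den(r)⁷ ≤ 2^{3·N!}` at every level point, so node 15's
    quality-2 inequality fails at every level point and `ThinFibreAt 2 (T j) ↔ LevelFinite (T j)`).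
HONESTY.  Rung 0 (`FiniteOrderLiouvilleSchanuel`, item 33364; 33363; 31077; the uniform `ThinFibre 2`; every binder of
record) is UNMOVED; (L) is INEFFECTIVE here; the standing witnesses W4 (non-dominant) and X3 = `x³ + Y·x + Y⁷`
(dominant-far, NOT lacunary) are NOT reached; `GaussAt 3 (T j)` and the lacunary ladder decide `T j` at every
`m₀ ≥ 3` — the new content is the residual quality `m₀ = 2` together with `LevelFinite` / `SiegelClause`.
-/

noncomputable section

namespace Summit.Schanuel.Schanuel.Theorems.RootDecomp1KSuperellipticSiegel

open Polynomial IsDedekindDomain NumberField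
open scoped Classical WithZero
open Literature.NumberTheory.DiophantineGeometry (finite_unitEquation exists_finite_forall_mem_integer_algebraMap
  valuation_algebraMap_eq_one_of_mem_integer_inv valuation_eq_one_of_mul_eq_one)
open IsDedekindDomain.HeightOneSpectrum (setOf_valuation_ne_one_finite setOf_one_lt_valuation_finite)
open Summit.Schanuel.Schanuel.Theorems.RootDecomp1KHyperellipticSiegel (setOf_ne_and_valuation_sub_ne_one_finite)

universe u

/-! ### §L  THE SUPERELLIPTIC SIEGEL–LEVEQUE THEOREM `y^m = f(x)`, `m ≥ 3`, FROM THE UNIT EQUATION -/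

section Local

variable {F : Type*} [Field F] (v : Valuation F ℤᵐ⁰)

/-- **THE LOCAL LEMMA AT A SIMPLE ROOT** (Siegel; the tree's `two_dvd_log_map_sub_of_sq_eq_mul_prod` with `m` for
`2`): if `y^m = c·∏_{e ∈ s}(x − e)` with `v(c) = 1`, `x` and `e₀ ∈ s` integral at `v`, and `e₀ − e` a `v`-unit for
every OTHER member `e` of `s` (so `e₀` is simple), then `m ∣ ord_v(x − e₀)` — at most one factor `x − e` can fail
to be a `v`-unit (for `x = e₀` the statement holds with Mathlib's junk value `log 0 = 0`). -/
theorem natCast_dvd_log_map_sub_of_pow_eq_mul_prod {m : ℕ} {s : Multiset F} {c x y e₀ : F}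
    (hy : y ^ m = c * (s.map (x - ·)).prod) (hc : v c = 1) (hx : v x ≤ 1) (he₀ : v e₀ ≤ 1)
    (hmem : e₀ ∈ s) (hdiff : ∀ e ∈ s.erase e₀, v (e₀ - e) = 1) :
    (m : ℤ) ∣ WithZero.log (v (x - e₀)) := by
  have hprod : (s.map (x - ·)).prod = (x - e₀) * ((s.erase e₀).map (x - ·)).prod := by
    conv_lhs => rw [← Multiset.cons_erase hmem]
    rw [Multiset.map_cons, Multiset.prod_cons]
  rcases (v.map_sub_le hx he₀).lt_or_eq with hlt | heq
  · have h1 : ∀ e ∈ s.erase e₀, v (x - e) = 1 := fun e he => by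
      have hxe : x - e = (x - e₀) + (e₀ - e) := by ring
      rw [hxe, v.map_add_eq_of_lt_right (by rw [hdiff e he]; exact hlt), hdiff e he]
    have h2 : v (((s.erase e₀).map (x - ·)).prod) = 1 := by
      rw [map_multiset_prod, Multiset.map_map]
      refine Multiset.prod_eq_one fun a ha => ?_
      obtain ⟨e, he, rfl⟩ := Multiset.mem_map.mp ha
      exact h1 e he
    have key : v y ^ m = v (x - e₀) := by
      rw [← map_pow, hy, map_mul, hc, one_mul, hprod, map_mul, h2, mul_one]
    have hlog := congrArg WithZero.log key
    rw [WithZero.log_pow, nsmul_eq_mul] at hlog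
    exact ⟨WithZero.log (v y), hlog.symm⟩
  · rw [heq, WithZero.log_one]
    exact dvd_zero _

/-- an `m`-th root of unity is a unit at every place. -/
theorem map_eq_one_of_pow_eq_one {m : ℕ} (hm : m ≠ 0) {ρ : F} (hρ : ρ ^ m = 1) : v ρ = 1 := by
  have hle : v ρ ≤ 1 := (pow_le_one_iff hm).mp (by rw [← map_pow, hρ, map_one])
  have hle' : v (ρ ^ (m - 1)) ≤ 1 := by rw [map_pow]; exact pow_le_one' hle _
  exact (valuation_eq_one_of_mul_eq_one v hle hle' (by rw [mul_pow_sub_one hm, hρ, map_one])).1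

/-- **THE COFACTOR IDENTITY** `(Σ_{j<m} w₁^j (ρw₂)^{m−1−j}) · (w₁ − ρ·w₂) = e₂ − e₁` for `w₁^m = x − e₁`,
`w₂^m = x − e₂`, `ρ^m = 1` (`geom_sum₂_mul`). -/
theorem geomSum_mul_sub_eq {m : ℕ} {x e₁ e₂ w₁ w₂ ρ : F} (h₁ : w₁ ^ m = x - e₁) (h₂ : w₂ ^ m = x - e₂)
    (hρ : ρ ^ m = 1) :
    (∑ j ∈ Finset.range m, w₁ ^ j * (ρ * w₂) ^ (m - 1 - j)) * (w₁ - ρ * w₂) = e₂ - e₁ := by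
  rw [geom_sum₂_mul, mul_pow, hρ, one_mul, h₁, h₂]
  ring

/-- **THE SIEGEL FACTORS ARE UNITS**: at a place `v` where `x, e₁, e₂` are integral and `e₂ − e₁` is a unit, if
`w₁^m = x − e₁`, `w₂^m = x − e₂` (`m ≠ 0`) and `ρ^m = 1`, then `w₁ − ρ·w₂` is a `v`-unit — it divides the unit
`e₂ − e₁` with an integral cofactor. -/
theorem map_sub_mul_eq_one {m : ℕ} (hm : m ≠ 0) {x e₁ e₂ w₁ w₂ ρ : F} (h₁ : w₁ ^ m = x - e₁)
    (h₂ : w₂ ^ m = x - e₂) (hρ : ρ ^ m = 1) (hx : v x ≤ 1) (he₁ : v e₁ ≤ 1) (he₂ : v e₂ ≤ 1)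
    (h21 : v (e₂ - e₁) = 1) : v (w₁ - ρ * w₂) = 1 := by
  have hw₁ : v w₁ ≤ 1 := (pow_le_one_iff hm).mp (by rw [← map_pow, h₁]; exact v.map_sub_le hx he₁)
  have hw₂ : v w₂ ≤ 1 := (pow_le_one_iff hm).mp (by rw [← map_pow, h₂]; exact v.map_sub_le hx he₂)
  have hρ1 : v ρ = 1 := map_eq_one_of_pow_eq_one v hm hρ
  have hρw₂ : v (ρ * w₂) ≤ 1 := by rw [map_mul, hρ1, one_mul]; exact hw₂
  have hq : v (∑ j ∈ Finset.range m, w₁ ^ j * (ρ * w₂) ^ (m - 1 - j)) ≤ 1 :=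
    v.map_sum_le fun j _ => by
      rw [map_mul, map_pow, map_pow]
      exact mul_le_one' (pow_le_one' hw₁ _) (pow_le_one' hρw₂ _)
  exact (valuation_eq_one_of_mul_eq_one v hq (v.map_sub_le hw₁ hρw₂)
    (by rw [geomSum_mul_sub_eq h₁ h₂ hρ, h21])).2

/-- **SIEGEL'S IDENTITY** for the three factors `uᵢ = w₁ − ζ^i w₂`: `(1 + ζ)·u₁ = ζ·u₀ + u₂`. -/
theorem siegel_identity_pow (w₁ w₂ ζ : F) :
    (1 + ζ) * (w₁ - ζ * w₂) = ζ * (w₁ - w₂) + (w₁ - ζ ^ 2 * w₂) := by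
  ring

/-- **RECOVERING `x` FROM THE UNIT** `κ = u₀/u₁ = (w₁ − w₂)/(w₁ − ζw₂)`: with `t := (1 − κζ)/(1 − κ)` one has
`t = w₁/w₂` and `x = (e₁ − t^m·e₂)/(1 − t^m)`. -/
theorem eq_of_ratio {m : ℕ} {x e₁ e₂ w₁ w₂ ζ κ : F} (h₁ : w₁ ^ m = x - e₁) (h₂ : w₂ ^ m = x - e₂)
    (h12 : e₁ ≠ e₂) (hζ : ζ ≠ 1) (hx₂ : x ≠ e₂) (hu₁ : w₁ - ζ * w₂ ≠ 0)
    (hκ : κ = (w₁ - w₂) / (w₁ - ζ * w₂)) :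
    ((1 - κ * ζ) / (1 - κ)) ^ m ≠ 1 ∧
      x = (e₁ - ((1 - κ * ζ) / (1 - κ)) ^ m * e₂) / (1 - ((1 - κ * ζ) / (1 - κ)) ^ m) := by
  have hm : m ≠ 0 := fun hm => by
    rw [hm, pow_zero] at h₁ h₂
    exact h12 (by linear_combination h₁ - h₂)
  have hw₂ : w₂ ≠ 0 := fun h0 => by
    rw [h0, zero_pow hm] at h₂
    exact hx₂ (sub_eq_zero.mp h₂.symm)
  have hζ1 : (1 : F) - ζ ≠ 0 := sub_ne_zero.mpr (Ne.symm hζ)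
  have h1κ : 1 - κ = (1 - ζ) * w₂ / (w₁ - ζ * w₂) := by
    rw [hκ, eq_div_iff hu₁, sub_mul, div_mul_cancel₀ _ hu₁]; ring
  have h1κζ : 1 - κ * ζ = (1 - ζ) * w₁ / (w₁ - ζ * w₂) := by
    rw [hκ, eq_div_iff hu₁, sub_mul, div_mul_eq_mul_div, div_mul_cancel₀ _ hu₁]; ring
  have ht : (1 - κ * ζ) / (1 - κ) = w₁ / w₂ := by
    rw [h1κ, h1κζ, div_div_div_cancel_right₀ hu₁, mul_div_mul_left _ _ hζ1]
  have hx₂' : x - e₂ ≠ 0 := sub_ne_zero.mpr hx₂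
  have hρ : (w₁ / w₂) ^ m * (x - e₂) = x - e₁ := by rw [div_pow, h₁, h₂, div_mul_cancel₀ _ hx₂']
  have hne : (w₁ / w₂) ^ m ≠ 1 := fun h1 => by
    rw [h1, one_mul] at hρ
    exact h12 (by linear_combination hρ)
  rw [ht]
  refine ⟨hne, eq_div_of_mul_eq (sub_ne_zero.mpr (Ne.symm hne)) ?_⟩
  linear_combination (-1 : F) * hρ

end Local

/-- **THE KUMMER FIELD `L(ⁿ√L(T,n))`** (the tree's `exists_numberField_forall_mem_selmerGroup_isSquare` with `n` for
`2`): for a number field `L`, a finite set `T` of finite places and `0 < n` there is a number field `F ⊇ L` — the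
splitting field of `∏_c (X^n − r_c)` over representatives `r_c` of the finitely many classes `c ∈ L(T, n)`
(`NumberField.finite_selmerGroup`) — in which every `a ∈ Lˣ` whose class lies in `L(T, n)` is an `n`-th power. -/
theorem exists_numberField_forall_mem_selmerGroup_isPow (L : Type u) [Field L] [NumberField L]
    {T : Set (HeightOneSpectrum (𝓞 L))} (hT : T.Finite) {n : ℕ} (hn : 0 < n) :
    ∃ (F : Type u) (_ : Field F) (_ : NumberField F) (_ : Algebra L F),
      ∀ a : Lˣ, (QuotientGroup.mk a : Lˣ ⧸ (powMonoidHom n : Lˣ →* Lˣ).range) ∈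
          selmerGroup (R := 𝓞 L) (K := L) (S := T) (n := n) →
        ∃ w : F, w ^ n = algebraMap L F a := by
  haveI := NumberField.finite_selmerGroup L hT hn
  set Sel := selmerGroup (R := 𝓞 L) (K := L) (S := T) (n := n) with hSel
  haveI : Fintype Sel := Fintype.ofFinite Sel
  have hrep : ∀ c : Sel, ∃ r : Lˣ,
      (QuotientGroup.mk r : Lˣ ⧸ (powMonoidHom n : Lˣ →* Lˣ).range) = (c : Lˣ ⧸ _) :=
    fun c => QuotientGroup.mk_surjective (c : Lˣ ⧸ (powMonoidHom n : Lˣ →* Lˣ).range)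
  choose rep hrep using hrep
  let p : L[X] := ∏ c : Sel, (X ^ n - C ((rep c : Lˣ) : L))
  let F : Type u := p.SplittingField
  haveI : NumberField F := NumberField.of_module_finite L F
  refine ⟨F, inferInstance, inferInstance, inferInstance, fun a ha => ?_⟩
  have hc := hrep ⟨_, ha⟩
  rw [QuotientGroup.eq] at hc
  obtain ⟨z, hz⟩ := hc
  rw [powMonoidHom_apply] at hz
  have hp0 : p ≠ 0 := by
    refine Finset.prod_ne_zero_iff.mpr fun c _ => ?_
    exact (monic_X_pow_sub_C _ hn.ne').ne_zero
  have hsplits : (p.map (algebraMap L F)).Splits := SplittingField.splits p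
  have hdvd : (X ^ n - C ((rep ⟨_, ha⟩ : Lˣ) : L)).map (algebraMap L F) ∣ p.map (algebraMap L F) :=
    Polynomial.map_dvd _ (Finset.dvd_prod_of_mem _ (Finset.mem_univ _))
  have hroot := (hsplits.of_dvd (Polynomial.map_ne_zero hp0) hdvd).exists_eval_eq_zero (by
    rw [Polynomial.map_sub, Polynomial.map_pow, map_X, map_C, degree_X_pow_sub_C hn]
    exact_mod_cast hn.ne')
  obtain ⟨ρ, hρ⟩ := hroot
  rw [Polynomial.map_sub, Polynomial.map_pow, map_X, map_C, eval_sub, eval_pow, eval_X, eval_C,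
    sub_eq_zero] at hρ
  have ha' : (a : L) = (rep ⟨_, ha⟩ : Lˣ) * (z : L) ^ n := by
    have hz' : ((z : Lˣ) : L) ^ n = ((rep ⟨_, ha⟩ : Lˣ) : L)⁻¹ * a := by
      have := congrArg (fun u : Lˣ => (u : L)) hz
      simpa using this
    rw [hz', ← mul_assoc, mul_inv_cancel₀ (Units.ne_zero _), one_mul]
  refine ⟨ρ * algebraMap L F z, ?_⟩
  rw [ha', map_mul, map_pow, mul_pow, hρ]

/-- **THE FIELD TOWER STEP `F₁ ⊆ F₂ = F₁(ⁿ√F₁(T₁,n))`**: a number field `F₂ ⊇ F₁` in which EVERY `h ∈ F₁×` whose order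
at every place outside `T₁` is DIVISIBLE BY `n` is a non-zero `n`-th power (`IsDedekindDomain.mk_mem_selmerGroup_iff`
+ `exists_numberField_forall_mem_selmerGroup_isPow`). -/
theorem exists_numberField_forall_isPow_of_dvd (F₁ : Type u) [Field F₁] [NumberField F₁]
    {T₁ : Set (HeightOneSpectrum (𝓞 F₁))} (hT₁ : T₁.Finite) {n : ℕ} (hn : 0 < n) :
    ∃ (F₂ : Type u) (_ : Field F₂) (_ : NumberField F₂) (_ : Algebra F₁ F₂),
      ∀ h : F₁, h ≠ 0 → (∀ v : HeightOneSpectrum (𝓞 F₁), v ∉ T₁ → (n : ℤ) ∣ WithZero.log (v.valuation F₁ h)) →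
        ∃ w : F₂, w ≠ 0 ∧ w ^ n = algebraMap F₁ F₂ h := by
  obtain ⟨F₂, i₁, i₂, i₃, hpow⟩ := exists_numberField_forall_mem_selmerGroup_isPow F₁ hT₁ hn
  refine ⟨F₂, i₁, i₂, i₃, fun h hh0 hdvd => ?_⟩
  have hmem : (QuotientGroup.mk (Units.mk0 h hh0) : F₁ˣ ⧸ (powMonoidHom n : F₁ˣ →* F₁ˣ).range) ∈
      selmerGroup (R := 𝓞 F₁) (K := F₁) (S := T₁) (n := n) := by
    rw [IsDedekindDomain.mk_mem_selmerGroup_iff]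
    intro v hv
    exact_mod_cast hdvd v hv
  obtain ⟨w, hw⟩ := hpow _ hmem
  rw [Units.val_mk0] at hw
  have hw0 : w ≠ 0 := by
    intro h0
    rw [h0, zero_pow hn.ne'] at hw
    exact (map_ne_zero_iff _ (algebraMap F₁ F₂).injective).mpr hh0 hw.symm
  exact ⟨w, hw0, hw⟩

/-- **THE BAD PLACES ARE FINITE**: for a number field `F₁`, a finite `TF`, `lc ≠ 0`, a finite family of roots `s`
and `1 + ζ ≠ 0`, there is a finite set `T₁ ⊇ TF` of finite places outside which `lc`, every root difference
`e − e'` (`e ≠ e'` in `s`) and `1 + ζ` are units and every root is integral (`setOf_valuation_ne_one_finite`,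
`setOf_one_lt_valuation_finite`, node 23's `setOf_ne_and_valuation_sub_ne_one_finite`). -/
theorem exists_finite_places (F₁ : Type u) [Field F₁] [NumberField F₁] {TF : Set (HeightOneSpectrum (𝓞 F₁))}
    (hTF : TF.Finite) {lc : F₁} (hlc : lc ≠ 0) (s : Multiset F₁) {ζ : F₁} (h1ζ : 1 + ζ ≠ 0) :
    ∃ T₁ : Set (HeightOneSpectrum (𝓞 F₁)), T₁.Finite ∧ (∀ v, v ∉ T₁ → v ∉ TF) ∧
      (∀ v, v ∉ T₁ → v.valuation F₁ lc = 1) ∧ (∀ v, v ∉ T₁ → ∀ e ∈ s, v.valuation F₁ e ≤ 1) ∧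
      (∀ v, v ∉ T₁ → ∀ e ∈ s, ∀ e' ∈ s, e ≠ e' → v.valuation F₁ (e - e') = 1) ∧
      (∀ v, v ∉ T₁ → v.valuation F₁ (1 + ζ) = 1) := by
  let T₁ : Set (HeightOneSpectrum (𝓞 F₁)) :=
    TF ∪ {v | v.valuation F₁ lc ≠ 1} ∪ (⋃ e ∈ s.toFinset, {v | 1 < v.valuation F₁ e}) ∪
      (⋃ e ∈ s.toFinset, ⋃ e' ∈ s.toFinset, {v | e ≠ e' ∧ v.valuation F₁ (e - e') ≠ 1}) ∪
      {v | v.valuation F₁ (1 + ζ) ≠ 1}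
  have hT₁ : T₁.Finite := by
    refine ((((hTF.union (setOf_valuation_ne_one_finite hlc)).union
      (Set.Finite.biUnion s.toFinset.finite_toSet fun e _ => setOf_one_lt_valuation_finite e)).union
      (Set.Finite.biUnion s.toFinset.finite_toSet fun e _ =>
        Set.Finite.biUnion s.toFinset.finite_toSet fun e' _ => setOf_ne_and_valuation_sub_ne_one_finite e e')).union
      (setOf_valuation_ne_one_finite h1ζ))
  refine ⟨T₁, hT₁, fun v hv h0 => hv (Or.inl (Or.inl (Or.inl (Or.inl h0)))), fun v hv => ?_, fun v hv e he => ?_,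
    fun v hv e he e' he' hne => ?_, fun v hv => ?_⟩
  · by_contra h0; exact hv (Or.inl (Or.inl (Or.inl (Or.inr h0))))
  · by_contra h0
    exact hv (Or.inl (Or.inl (Or.inr (Set.mem_biUnion (Multiset.mem_toFinset.mpr he) (not_le.mp h0)))))
  · by_contra h0
    exact hv (Or.inl (Or.inr (Set.mem_biUnion (Multiset.mem_toFinset.mpr he)
      (Set.mem_biUnion (Multiset.mem_toFinset.mpr he') ⟨hne, h0⟩))))
  · by_contra h0; exact hv (Or.inr h0)

end Summit.Schanuel.Schanuel.Theorems.RootDecomp1KSuperellipticSiegel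

end
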